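import Summits.MatrixMultiplication.OmegaCensus.DihedralTPPFamilyGeneral

/-!
# ω-census, family (b3): TPP volume of `D_{6m}` is at least `8m = (4/3)·|G|` for every `m`

HONEST FRAMING (pub-omega census; verbatim): lottery ticket; floor = certified bounds/negative ranges.
Cardinality bookkeeping for the dihedral TPP family of `DihedralTPPFamilyGeneral.lean` (`dihedral_family_tpp`): the halves
`{r^{3j}}` and `{s r^{2+3j}}` of the third set each contain the `m` distinct elements indexed by `i < m` (injectivity of
`i ↦ 3i` below `3m`, `ZMod.natCast_eq_natCast_iff'`), they are disjoint (rotations vs reflections), and `|S| = |T| = 2`; hence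
(`dihedral_family_volume`) every dihedral group `D_{6m}` has a TPP triple of volume `≥ 8m = (4/3)|D_{6m}|` — the lower half of the
census law `β(D_{2n}) = 4⌊2n/3⌋` (the upper half is SAT/DRAT evidence for `n ≤ 24`, kit j086172, no proof claimed).
For comparison `Σ dᵢ³ = 2|G| − 2` or `2|G| − 4` for dihedral groups, so this family stays a factor `3/2` below the sum of the cubes.
-/

namespace Summit.MatrixMultiplication.OmegaCensus
open Literature.Combinatorics.Additive Finset

/-- The rotation half `{r^{3j}}` of the family's third set has exactly `m` elements: `j ↦ 3j` on `ZMod (3m)` takes each value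
at least `m` times over: the `m` elements `r^{3i}`, `i < m`, are distinct (we count via the injective parametrisation `i ↦ 3·i`, `i < m`). [folklore] -/
theorem card_image_r_three_mul (m : ℕ) [NeZero m] :
    m ≤ ((univ : Finset (ZMod (3 * m))).image fun j => DihedralGroup.r (3 * j)).card := by
  -- the m elements r(3i), i < m, are distinct
  have hinj : Function.Injective fun i : Fin m => (DihedralGroup.r (3 * ((i : ℕ) : ZMod (3 * m))) : DihedralGroup (3 * m)) := by
    intro i i' h
    simp only [DihedralGroup.r.injEq] at h
    have h3 : ((3 * (i : ℕ) : ℕ) : ZMod (3 * m)) = ((3 * (i' : ℕ) : ℕ) : ZMod (3 * m)) := by push_cast; exact h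
    rw [ZMod.natCast_eq_natCast_iff'] at h3
    have hi := i.isLt; have hi' := i'.isLt
    rw [Nat.mod_eq_of_lt (by omega), Nat.mod_eq_of_lt (by omega)] at h3
    exact Fin.ext (by omega)
  calc m = (univ : Finset (Fin m)).card := by simp
    _ = ((univ : Finset (Fin m)).image fun i : Fin m =>
          (DihedralGroup.r (3 * ((i : ℕ) : ZMod (3 * m))) : DihedralGroup (3 * m))).card :=
        (card_image_of_injective _ hinj).symm
    _ ≤ _ := by
        apply card_le_card
        intro x hx
        simp only [mem_image, mem_univ, true_and] at hx ⊢
        obtain ⟨i, rfl⟩ := hx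
        exact ⟨((i : ℕ) : ZMod (3 * m)), rfl⟩

/-- Likewise for the reflection half `{s r^{2+3j}}`. [folklore] -/
theorem card_image_sr_three_mul (m : ℕ) [NeZero m] :
    m ≤ ((univ : Finset (ZMod (3 * m))).image fun j => DihedralGroup.sr (2 + 3 * j)).card := by
  have hinj : Function.Injective fun i : Fin m => (DihedralGroup.sr (2 + 3 * ((i : ℕ) : ZMod (3 * m))) : DihedralGroup (3 * m)) := by
    intro i i' h
    simp only [DihedralGroup.sr.injEq, add_right_inj] at h
    have h3 : ((3 * (i : ℕ) : ℕ) : ZMod (3 * m)) = ((3 * (i' : ℕ) : ℕ) : ZMod (3 * m)) := by push_cast; exact h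
    rw [ZMod.natCast_eq_natCast_iff'] at h3
    have hi := i.isLt; have hi' := i'.isLt
    rw [Nat.mod_eq_of_lt (by omega), Nat.mod_eq_of_lt (by omega)] at h3
    exact Fin.ext (by omega)
  calc m = (univ : Finset (Fin m)).card := by simp
    _ = ((univ : Finset (Fin m)).image fun i : Fin m =>
          (DihedralGroup.sr (2 + 3 * ((i : ℕ) : ZMod (3 * m))) : DihedralGroup (3 * m))).card :=
        (card_image_of_injective _ hinj).symm
    _ ≤ _ := by
        apply card_le_card
        intro x hx
        simp only [mem_image, mem_univ, true_and] at hx ⊢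
        obtain ⟨i, rfl⟩ := hx
        exact ⟨((i : ℕ) : ZMod (3 * m)), rfl⟩

/-- **TPP volume of `D_{6m}` is at least `8m = (4/3)|G|`** (lower half of the census law `β(D_{2n}) = 4⌊2n/3⌋` on `3 ∣ n`):
the family triple of `dihedral_family_tpp` has `|S| = |T| = 2` and `|U| ≥ 2m` (the two halves of `U` are disjoint: rotations vs reflections). [folklore] -/
theorem dihedral_family_volume (m : ℕ) [NeZero m] :
    ∃ S T U : Finset (DihedralGroup (3 * m)), TripleProductProperty S T U ∧ 8 * m ≤ S.card * T.card * U.card := by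
  refine ⟨_, _, _, dihedral_family_tpp m, ?_⟩
  have hS : ({DihedralGroup.r 0, DihedralGroup.sr 0} : Finset (DihedralGroup (3 * m))).card = 2 := by
    rw [card_insert_of_notMem (by rw [mem_singleton]; intro h; cases h), card_singleton]
  have hT : ({DihedralGroup.r 0, DihedralGroup.sr 1} : Finset (DihedralGroup (3 * m))).card = 2 := by
    rw [card_insert_of_notMem (by rw [mem_singleton]; intro h; cases h), card_singleton]
  have hdisj : Disjoint ((univ : Finset (ZMod (3 * m))).image fun j => DihedralGroup.r (3 * j))
      ((univ : Finset (ZMod (3 * m))).image fun j => DihedralGroup.sr (2 + 3 * j)) := by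
    rw [disjoint_left]
    intro x hx hx'
    simp only [mem_image, mem_univ, true_and] at hx hx'
    obtain ⟨j, rfl⟩ := hx
    obtain ⟨j', h⟩ := hx'
    cases h
  have hU := card_union_of_disjoint hdisj
  have h1 := card_image_r_three_mul m
  have h2 := card_image_sr_three_mul m
  rw [hS, hT, hU]
  omega

end Summit.MatrixMultiplication.OmegaCensus
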